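import Summits.CriticalPhenomena.Ising3D.Control2DCornerAsymptotics
import Mathlib.Analysis.SpecialFunctions.Pow.Real
import Mathlib.Tactic.Linarith
import Mathlib.Tactic.Positivity
import Mathlib.Tactic.FieldSimp
import Mathlib.Tactic.Ring
import HarnessLib

/-!
# The states of the diagonal expansion: `G(x,x) - 1 = Σ_{(i,m,m')} 2 p_i a_m(h_i) a_{m'}(h̄_i) x^{Δ_i+m+m'}` and the integrated
# weighted spectral density `F(E)` of Pappadopulo–Rychkov–Espin–Rattazzi 2012 §4.2, for the typed class
(cell `pub-ising3x`, seat controls-1 gen 45; PAPER §6.2 / Appendix E — CONTROL-ONLY; part 1 of 2, part 2 is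
`Control2DSpectralDensityAsymptotics`)

HONEST FRAMING: lottery ticket; floor = tightest certified 3D Ising CFT bounds; no exact-solution
claim without a proof. CONTROL-ONLY (`d = 2`, global `sl(2) × sl(2)` blocks, `Δ_σ = s` an INPUT, axiom set
`A2D′`); nothing here is about `d = 3`, no certificate, functional or number of the record is touched, and no
new hypothesis or named fact enters.

WHAT THIS FILE ADDS. Pappadopulo–Rychkov–Espin–Rattazzi 2012 §4.2 write the four-point function of identical scalars
in the reflection-positive configuration (`x₁ = 0`, `x₄ = ∞`, `x₂, x₃` on one ray — i.e. `z = z̄ = x = e^{-β}`, the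
real diagonal) as the Laplace transform of a «weighted spectral density», their eq. (4.5)
`ℒ(β) = ∫₀^∞ f(E) e^{-βE} dE`, `f(E) = Σ_k ρ_k δ(E - E_k)`, «the energies `E_k` run over all the states present in
the theory, primaries or not … all of these coefficients are positive», and study its integral `F(E) = ∫₀^E f`
(their (4.8)). For the typed two-dimensional class these states are EXPLICIT: on the diagonal
`g_{Δ,ℓ}(x,x) = 2 k_{2h}(x) k_{2h̄}(x) = Σ_{m,m'} 2 a_m(h) a_{m'}(h̄) x^{Δ+m+m'}` (`a_m(h) = (h)_m²/(m!(2h)_m) ≥ 0` the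
coefficients of `k_{2h}(x) = x^h Σ_m a_m x^m`, `chiralCoeff`; `(m,m')` the levels of the `sl(2) × sl(2)` descendants
of the pair `(h,h̄), (h̄,h)`, which coincide on the diagonal — the factor `2`), so
`G(x,x) - 1 = Σ_{(i,m,m')} 2 p_i a_m(h_i) a_{m'}(h̄_i) x^{Δ_i+m+m'}`. This file types the states and their
integrated density; the sequel applies the tree's Karamata Tauberian theorem to them.

* `CrossingData.diagWeight D (i,m,m') = 2 p_i a_m(h_i) a_{m'}(h̄_i)`, `CrossingData.diagLevel D (i,m,m') = Δ_i + m + m'`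
  (`_nonneg` for unitary data); `hasSum_diagStates_fiber` — one conformal family: `Σ_{(m,m')} W x^E = p_i g_i(x,x)`;
  **`hasSum_diagStates (hU) (hconv)`** — `Σ_{(i,m,m')} W x^E = G(x,x) - 1` on `x ∈ (0,1)` (PRER (4.5) for the typed
  class: non-negative family, fibrewise sums, Mathlib `summable_prod_of_nonneg` + `HasSum.prod_fiberwise`);
  `hasSum_laplace` — the same at `x = e^{-t}`: `Σ W e^{-tE} = G(e^{-t},e^{-t}) - 1`;
* **`CrossingData.spectralCount D E := 1 + Σ'_{j : E_j ≤ E} W_j`** — PRER's integrated weighted spectral density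
  `F(E)` (4.8), the vacuum's unit weight at `E = 0` included as printed; `summable_subtype_le_of_summable_exp`,
  `summable_diagWeight_le` (the states below any level carry finite weight);
* `two_mul_tsum_p_le`, **`tsum_p_le_spectralCount`** — the quasi-primaries alone: `Σ'_{Δ_i ≤ E} p_i ≤ (F(E) - 1)/2`
  (the sub-family `(i,0,0)`, `a_0 = 1`).

NOT claimed: any asymptotics (part 2); that these weights are norms of states of a CFT Hilbert space (they are DEFINED
from the datum and the closed-form blocks); anything off the REAL diagonal; Virasoro; anything three-dimensional; no
number of the record touched.

References: D. Pappadopulo, S. Rychkov, J. Espin, R. Rattazzi, Phys. Rev. D 86 (2012) 105043, §4.2 eq. (4.5), (4.8)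
[cite: PappadopuloRychkovEspinRattazzi2012PRD, §4.2]; F. A. Dolan, H. Osborn, Nucl. Phys. B 678 (2004) 491, §3
[cite: DolanOsborn2004, §3]; R. Rattazzi, V. S. Rychkov, E. Tonni, A. Vichi, JHEP 12 (2008) 031, §3
[cite: RattazziEtAl2008, §3]. Tree: `hasSum_blockPair`, `chiralCoeff`, `chiralCoeff_nonneg`, `pairPow` (`Control2DTermwise`);
`chiralCoeff_zero_right` (`Control2DVertexAlgebra`); `globalBlock` (`Control2DBootstrap`); `fourPoint`, `OpeConvergent`
(`Control2DFourPoint`). Mathlib: `summable_prod_of_nonneg`, `HasSum.prod_fiberwise`, `Summable.tsum_le_tsum_of_inj`,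
`Summable.comp_injective`, `Real.exp_mul`, `Real.add_one_le_exp`.
-/

namespace Summit.CriticalPhenomena.Ising3D.Control2D

open Set Filter Topology
open Literature.MathematicalPhysics.QuantumFieldTheory.ConformalBootstrap3D

/-! ### A summability lemma for weighted families -/

section Weighted

variable {J : Type*} {w E : J → ℝ}

/-- The sub-family of a weighted family below a level is summable as soon as `Σ_j w_j e^{-E_j}` converges
(`w_j ≤ e^T · w_j e^{-E_j}` when `E_j ≤ T`). [folklore] -/
theorem summable_subtype_le_of_summable_exp (hw : ∀ j, 0 ≤ w j)
    (hsum : Summable fun j => w j * Real.exp (-(1 * E j))) (T : ℝ) :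
    Summable fun j : ↥({j : J | E j ≤ T} : Set J) => w j := by
  have h1 : Summable fun j : ↥({j : J | E j ≤ T} : Set J) =>
      Real.exp T * (w j * Real.exp (-(1 * E j))) := (hsum.subtype _).mul_left (Real.exp T)
  refine h1.of_nonneg_of_le (fun j => hw j) (fun j => ?_)
  have hj : E (j : J) ≤ T := j.2
  have hexp : 1 ≤ Real.exp T * Real.exp (-(1 * E (j : J))) := by
    rw [← Real.exp_add]
    linarith [Real.add_one_le_exp (T + -(1 * E (j : J)))]
  calc w j = w j * 1 := (mul_one _).symm
    _ ≤ w j * (Real.exp T * Real.exp (-(1 * E (j : J)))) := mul_le_mul_of_nonneg_left hexp (hw j)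
    _ = Real.exp T * (w j * Real.exp (-(1 * E (j : J)))) := by ring

/-- `(e^{-t})^E = e^{-tE}`. (`Real.exp_mul`). [folklore] -/
theorem exp_neg_rpow (t E : ℝ) : Real.exp (-t) ^ E = Real.exp (-(t * E)) := by
  rw [← Real.exp_mul, neg_mul]

end Weighted

/-! ### The states of the diagonal expansion of a typed datum -/

namespace CrossingData

variable {D : CrossingData} {s : ℝ}

/-- **The weight of the state `(i, m, m')` of the diagonal expansion**: `2 · p_i · a_m(h_i) · a_{m'}(h̄_i)`,
`h_i = (Δ_i + ℓ_i)/2`, `h̄_i = (Δ_i - ℓ_i)/2`, `a_m(h) = (h)_m²/(m!(2h)_m)` the coefficients of `k_{2h}(x) = x^h Σ a_m x^m`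
(`chiralCoeff`) — the `ρ_k` of Pappadopulo–Rychkov–Espin–Rattazzi 2012 eq. (4.5) for the typed 2D class (the pair
`(h,h̄), (h̄,h)` entered once, whence the diagonal factor `2`). [cite: PappadopuloRychkovEspinRattazzi2012PRD, §4.2] -/
noncomputable def diagWeight (D : CrossingData) (j : D.ι × ℕ × ℕ) : ℝ :=
  2 * D.p j.1 *
    (chiralCoeff ((D.Δ j.1 + D.spin j.1) / 2) j.2.1 * chiralCoeff ((D.Δ j.1 - D.spin j.1) / 2) j.2.2)

/-- **The level (energy) of the state `(i, m, m')`**: `E = Δ_i + m + m'` — the `E_k` of PRER eq. (4.5), «all the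
states present in the theory, primaries or not». [cite: PappadopuloRychkovEspinRattazzi2012PRD, §4.2] -/
noncomputable def diagLevel (D : CrossingData) (j : D.ι × ℕ × ℕ) : ℝ :=
  D.Δ j.1 + (j.2.1 : ℝ) + (j.2.2 : ℝ)

/-- **The integrated weighted spectral density of the diagonal expansion**, PRER eq. (4.8):
`F(E) = 1 + Σ'_{(i,m,m') : Δ_i + m + m' ≤ E} 2 p_i a_m(h_i) a_{m'}(h̄_i)` — the total `x`-expansion weight of
`G(x,x) = 1 + Σ_k ρ_k x^{E_k}` at levels `≤ E`, the vacuum's unit weight at `E = 0` included (an unconditional `tsum`;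
the sub-family is summable for OPE-convergent data, `summable_diagWeight_le`).
[cite: PappadopuloRychkovEspinRattazzi2012PRD, §4.2] -/
noncomputable def spectralCount (D : CrossingData) (E : ℝ) : ℝ :=
  1 + ∑' j : ↥({j : D.ι × ℕ × ℕ | D.diagLevel j ≤ E} : Set (D.ι × ℕ × ℕ)), D.diagWeight j

/-- The weights are `≥ 0` for unitary data (`p_i ≥ 0`, `a_m(h) ≥ 0` for `h ≥ 0`). [folklore] -/
theorem diagWeight_nonneg (hU : D.IsUnitary) (j : D.ι × ℕ × ℕ) : 0 ≤ D.diagWeight j := by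
  have hℓ : (0 : ℝ) ≤ D.spin j.1 := Nat.cast_nonneg _
  have h1 := (hU j.1).2.1
  unfold diagWeight
  exact mul_nonneg (mul_nonneg (by norm_num) (hU j.1).2.2)
    (mul_nonneg (chiralCoeff_nonneg (by linarith) _) (chiralCoeff_nonneg (by linarith) _))

/-- The levels are `≥ 0` for unitary data (`Δ_i ≥ ℓ_i ≥ 0`). [folklore] -/
theorem diagLevel_nonneg (hU : D.IsUnitary) (j : D.ι × ℕ × ℕ) : 0 ≤ D.diagLevel j := by
  have hℓ : (0 : ℝ) ≤ D.spin j.1 := Nat.cast_nonneg _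
  have h1 := (hU j.1).2.1
  have h2 : (0 : ℝ) ≤ j.2.1 := Nat.cast_nonneg _
  have h3 : (0 : ℝ) ≤ j.2.2 := Nat.cast_nonneg _
  unfold diagLevel
  linarith

/-- **One conformal family on the diagonal**: for a unitary label `i` and `x ∈ (0,1)`,
`Σ_{(m,m')} 2 p_i a_m(h_i) a_{m'}(h̄_i) x^{Δ_i+m+m'} = p_i g_i(x,x)` (`hasSum_blockPair` read on the diagonal, where
`pairPow a b x x = 2 x^{a+b}`). [cite: DolanOsborn2004, §3] -/
theorem hasSum_diagStates_fiber (hU : D.IsUnitary) (i : D.ι) {x : ℝ} (hx : x ∈ Ioo (0 : ℝ) 1) :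
    HasSum (fun mm : ℕ × ℕ => D.diagWeight (i, mm) * x ^ D.diagLevel (i, mm))
      (D.p i * globalBlock (D.Δ i) (D.spin i) x x) := by
  have hℓ : (0 : ℝ) ≤ D.spin i := Nat.cast_nonneg _
  have hΔ := (hU i).2.1
  have H := (hasSum_blockPair (h := (D.Δ i + D.spin i) / 2) (hb := (D.Δ i - D.spin i) / 2)
    (by linarith) (by linarith) hx hx).mul_left (D.p i)
  have hval : D.p i * (chiralBlock ((D.Δ i + D.spin i) / 2) x * chiralBlock ((D.Δ i - D.spin i) / 2) x +
      chiralBlock ((D.Δ i - D.spin i) / 2) x * chiralBlock ((D.Δ i + D.spin i) / 2) x) =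
      D.p i * globalBlock (D.Δ i) (D.spin i) x x := rfl
  rw [hval] at H
  refine H.congr_fun fun mm => ?_
  have e1 : x ^ ((D.Δ i + D.spin i) / 2 + (mm.1 : ℝ)) * x ^ ((D.Δ i - D.spin i) / 2 + (mm.2 : ℝ)) =
      x ^ D.diagLevel (i, mm) := by
    rw [← Real.rpow_add hx.1]
    unfold diagLevel
    congr 1
    ring
  have e2 : x ^ ((D.Δ i - D.spin i) / 2 + (mm.2 : ℝ)) * x ^ ((D.Δ i + D.spin i) / 2 + (mm.1 : ℝ)) =
      x ^ D.diagLevel (i, mm) := by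
    rw [mul_comm]
    exact e1
  show D.diagWeight (i, mm) * x ^ D.diagLevel (i, mm) =
    D.p i * (chiralCoeff ((D.Δ i + D.spin i) / 2) mm.1 * chiralCoeff ((D.Δ i - D.spin i) / 2) mm.2 *
      pairPow ((D.Δ i + D.spin i) / 2 + (mm.1 : ℝ)) ((D.Δ i - D.spin i) / 2 + (mm.2 : ℝ)) x x)
  unfold pairPow
  rw [e1, e2]
  unfold diagWeight
  ring

/-- **The diagonal expansion as a sum over states** (PRER eq. (4.5) for the typed class, with `x = e^{-β}`): for a
unitary datum whose expansion converges on the open square and `x ∈ (0,1)`,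
`Σ_{(i,m,m')} 2 p_i a_m(h_i) a_{m'}(h̄_i) x^{Δ_i+m+m'} = G(x,x) - 1` (non-negative family; fibrewise sums `p_i g_i(x,x)`,
Mathlib `summable_prod_of_nonneg` + `HasSum.prod_fiberwise`). [cite: PappadopuloRychkovEspinRattazzi2012PRD, §4.2] -/
theorem hasSum_diagStates (hU : D.IsUnitary) (hconv : D.OpeConvergent) {x : ℝ} (hx : x ∈ Ioo (0 : ℝ) 1) :
    HasSum (fun j : D.ι × ℕ × ℕ => D.diagWeight j * x ^ D.diagLevel j) (D.fourPoint x x - 1) := by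
  set f : D.ι × ℕ × ℕ → ℝ := fun j => D.diagWeight j * x ^ D.diagLevel j with hf
  have hf0 : 0 ≤ f := fun j => mul_nonneg (diagWeight_nonneg hU j) (Real.rpow_nonneg hx.1.le _)
  have hfib : ∀ i, HasSum (fun mm : ℕ × ℕ => f (i, mm)) (D.p i * globalBlock (D.Δ i) (D.spin i) x x) :=
    fun i => hasSum_diagStates_fiber hU i hx
  have hS : Summable f := by
    refine (summable_prod_of_nonneg hf0).mpr ⟨fun i => (hfib i).summable, ?_⟩
    have : (fun i => ∑' mm : ℕ × ℕ, f (i, mm)) = fun i => D.p i * globalBlock (D.Δ i) (D.spin i) x x :=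
      funext fun i => (hfib i).tsum_eq
    rw [this]
    exact hconv x x hx hx
  have h1 : HasSum (fun i => D.p i * globalBlock (D.Δ i) (D.spin i) x x) (∑' j, f j) :=
    hS.hasSum.prod_fiberwise hfib
  have h2 : ∑' j, f j = D.fourPoint x x - 1 := by
    rw [← h1.tsum_eq]
    unfold fourPoint
    ring
  rw [← h2]
  exact hS.hasSum

/-- **The Laplace form** (PRER eq. (4.5), `β = t`): for a unitary OPE-convergent datum and `t > 0`,
`Σ_{(i,m,m')} W e^{-tE} = G(e^{-t},e^{-t}) - 1`. [cite: PappadopuloRychkovEspinRattazzi2012PRD, §4.2] -/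
theorem hasSum_laplace (hU : D.IsUnitary) (hconv : D.OpeConvergent) {t : ℝ} (ht : 0 < t) :
    HasSum (fun j : D.ι × ℕ × ℕ => D.diagWeight j * Real.exp (-(t * D.diagLevel j)))
      (D.fourPoint (Real.exp (-t)) (Real.exp (-t)) - 1) := by
  have hx : Real.exp (-t) ∈ Ioo (0 : ℝ) 1 := ⟨Real.exp_pos _, Real.exp_lt_one_iff.mpr (by linarith)⟩
  refine (hasSum_diagStates hU hconv hx).congr_fun fun j => ?_
  rw [exp_neg_rpow]

/-- The states below any level carry finite total weight (OPE-convergent unitary data). [folklore] -/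
theorem summable_diagWeight_le (hU : D.IsUnitary) (hconv : D.OpeConvergent) (E : ℝ) :
    Summable fun j : ↥({j : D.ι × ℕ × ℕ | D.diagLevel j ≤ E} : Set (D.ι × ℕ × ℕ)) => D.diagWeight j :=
  summable_subtype_le_of_summable_exp (diagWeight_nonneg hU) (hasSum_laplace hU hconv one_pos).summable E

/-! ### The primaries alone -/

/-- **The quasi-primaries below `E` carry at most half the weight of the states below `E`**:
`2·Σ'_{Δ_i ≤ E} p_i ≤ Σ'_{E_j ≤ E} W_j` (the sub-family `(i,0,0)`, `a_0 = 1`; Mathlib `Summable.tsum_le_tsum_of_inj`).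
[folklore] -/
theorem two_mul_tsum_p_le (hU : D.IsUnitary) (hconv : D.OpeConvergent) (E : ℝ) :
    2 * ∑' i : ↥({i : D.ι | D.Δ i ≤ E} : Set D.ι), D.p i ≤
      ∑' j : ↥({j : D.ι × ℕ × ℕ | D.diagLevel j ≤ E} : Set (D.ι × ℕ × ℕ)), D.diagWeight j := by
  rw [← tsum_mul_left]
  let e : ↥({i : D.ι | D.Δ i ≤ E} : Set D.ι) → ↥({j : D.ι × ℕ × ℕ | D.diagLevel j ≤ E} : Set (D.ι × ℕ × ℕ)) :=
    fun i => ⟨((i : D.ι), 0, 0), by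
      show D.diagLevel ((i : D.ι), 0, 0) ≤ E
      simp only [diagLevel, Nat.cast_zero, add_zero]
      exact i.2⟩
  have he : Function.Injective e := by
    intro a b hab
    have h1 := congrArg (fun j : ↥({j : D.ι × ℕ × ℕ | D.diagLevel j ≤ E} : Set (D.ι × ℕ × ℕ)) =>
      (j : D.ι × ℕ × ℕ).1) hab
    exact Subtype.ext h1
  have hg := summable_diagWeight_le hU hconv E
  have hval : ∀ i : ↥({i : D.ι | D.Δ i ≤ E} : Set D.ι),
      2 * D.p (i : D.ι) = D.diagWeight ((e i : ↥({j : D.ι × ℕ × ℕ | D.diagLevel j ≤ E} : Set _)) : D.ι × ℕ × ℕ) :=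
    fun i => by
      show 2 * D.p (i : D.ι) = D.diagWeight ((i : D.ι), 0, 0)
      simp only [diagWeight, chiralCoeff_zero_right, mul_one]
  have hf : Summable fun i : ↥({i : D.ι | D.Δ i ≤ E} : Set D.ι) => 2 * D.p i :=
    (hg.comp_injective he).congr fun i => (hval i).symm
  exact Summable.tsum_le_tsum_of_inj e he (fun c _ => diagWeight_nonneg hU c) (fun i => (hval i).le) hf hg

/-- `Σ'_{Δ_i ≤ E} p_i ≤ (F(E) - 1)/2`. [folklore] -/
theorem tsum_p_le_spectralCount (hU : D.IsUnitary) (hconv : D.OpeConvergent) (E : ℝ) :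
    ∑' i : ↥({i : D.ι | D.Δ i ≤ E} : Set D.ι), D.p i ≤ (D.spectralCount E - 1) / 2 := by
  have h := two_mul_tsum_p_le hU hconv E
  rw [spectralCount]
  linarith

end CrossingData

end Summit.CriticalPhenomena.Ising3D.Control2D
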